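import Mathlib.Algebra.Order.Chebyshev
import Literature.Analysis.FluidPDE.ElgindiStabilityDecomposition
import Literature.Analysis.FluidPDE.ElgindiProfileTail
import HarnessLib

/-!
# Proof of the §2.6 datum fact of Elgindi–Ghoul–Masmoudi:
`ElgindiGhoulMasmoudi2021_compactSupportDatum_holds`

Topic `Literature/Analysis/FluidPDE`. Proof file (everything proved, no definitions, no named
facts) discharging the named fact
`Literature.Analysis.FluidPDE.Elgindi.ElgindiGhoulMasmoudi2021_compactSupportDatum` of
`ElgindiStabilityDecomposition.lean`: Elgindi–Ghoul–Masmoudi, *On the stability of self-similar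
blow-up for `C^{1,α}` solutions to the incompressible Euler equations on `ℝ³`*, Camb. J. Math. 9
(2021) = arXiv:1910.14071, **§2.6**, p. 9 of the held text: around a profile `F = aF_* + h`, `F`
of class `C⁴` in the open quarter strip and `|h|_{𝓗⁴} < ∞`, there are `C⁴` data `ε₀` of
arbitrarily small `𝓗⁴` functional with `L₁₂(ε₀)(0) = 0` and `F + ε₀ ≡ 0` for `z` large.

## The printed argument and its rendering

"let `χ ∈ C_c^∞([0,∞))` with `χ ≡ 1` on `[0,1]`, `χ ≡ 0` on `[2,∞)` … Consider
`ε₀^{M,β} = (χ(z/M) − 1)F + β sin(2θ)χ((z−3)²)`. Observe that `ε₀ + F` is compactly supported.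
Next, observe that `‖ε₀^{M,β}‖_{𝓗ᵏ} ≤ C/M^{1/4} + Cβ + Cα²`. This is just due to the fact that
`F = F_* + α²g` and `F_* ≈ αz⁻¹` as `z → ∞` and `|g|_{𝓗ᵏ} ≤ C`, while the `𝓗ᵏ` norm is like an `L²`
norm for large `z`. We also use Lemma 9.6 [radial multipliers]. … `a_M := L₁₂((χ(z/M) − 1)F)(0)`
… the fixed constant `b = L₁₂(sin(2θ)χ((z−3)²))(0) > 0`. Thus we define `β = −a_M/b`. Then
`L₁₂(ε^{M,β})(0) = 0`" (p. 9). Here: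

* the cut-off is `tailCut M = ψ(z/M)` (`ElgindiCutoffCalculus.lean`), the bump is
  `b = σ(z)F_*(z,θ)` with the radial bump `σ = bumpRadial` (support `[1,4]`) — its angular factor
  is `Γ/c` rather than `sin(2θ)`, which puts its `L₁₂` and its `𝓗⁴` functional on the same
  footing as those of `F_*` (`L₁₂(b)(0) = ∫ σ(r)·4α/(1+r)² dr > 0`,
  `L12_bumpRadial_mul_fundamentalProfile_pos`; `|b|_{𝓗⁴} < ∞`,
  `eHkNormSq_bumpRadial_mul_fundamentalProfile_ne_top`);
* **Lemma 9.6 in tail form** (`eL2Sq_iterate_radialMul_le`, `exists_eHkNormSq_radialMul_le`):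
  for a radial `c ∈ Cᵏ(ℝ)` with `|Dz₁^l c| ≤ B` (`l ≤ k`) vanishing on `z < M`,
  `|cf|²_{𝓗ᵏ} ≤ K(k,B) · max over the terms of ∫∫_{z ≥ M} |term(f)|²` — the Leibniz formula of
  `ElgindiStripCalculus.lean` and Cauchy–Schwarz in the `j+1` summands;
* the tails `∫∫_{z ≥ M}|term|² → 0` (`eventually_tails_le`): for `h` because `|h|_{𝓗⁴} < ∞`, for
  `F_*` by `ElgindiProfileTail.lean`; hence `|tailCut M · F|²_{𝓗⁴} → 0`
  (`tendsto_eHkNormSq_tailCut_radialMul`, through `F = aF_* + h` and the quasi-triangle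
  inequality `eHkNormSq_add_le`), and `a_M = L₁₂(tailCut M · F)(0) → 0`
  (`tendsto_L12_tailCut_radialMul`, dominated tails of the integrable `F K/r`);
* `β_M = −a_M/b`, `ε_M = tailCut M · F + β_M b`: `L₁₂(ε_M)(0) = 0` by the additivity of `L₁₂` at
  `0` (`ElgindiHkTools.lean`), `|ε_M|²_{𝓗⁴} ≤ 2|tailCut M · F|² + 2β_M²|b|² → 0`, and
  `F + ε_M = 0` for `z ≥ 2M ≥ 8`.

The quantitative rate `C/M^{1/4}` of the source is not needed for the vendored (qualitative)
statement and is not proved. Used: `ElgindiStripCalculus.lean`, `ElgindiHkTools.lean`,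
`ElgindiCutoffCalculus.lean`, `ElgindiProfileTail.lean`; from Mathlib `sq_sum_le_card_mul_sum_sq`,
`Filter.eventually_all_finset`, `ENNReal.tendsto_nhds_zero`, `Metric.tendsto_atTop`,
`integral_pos_iff_support_of_nonneg_ae`.
-/

noncomputable section

open MeasureTheory Set Function Real Filter Finset
open _root_.Topology
open scoped ENNReal

namespace Literature.Analysis.FluidPDE

namespace Elgindi

/-! ### Continuity of the mixed weight -/

/-- The mixed weight `W = w · sin(2θ)^{−γ/2}` is continuous on the open strip. [folklore] -/
theorem continuousOn_totalWeight (α : ℝ) : ContinuousOn (uncurry (totalWeight α)) strip := by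
  have h1 : ContinuousOn (fun p : ℝ × ℝ => radialWeight p.1) strip := by
    unfold radialWeight
    refine ContinuousOn.div (by fun_prop) (by fun_prop) fun p hp => ?_
    exact pow_ne_zero 2 (ne_of_gt hp.1)
  have h2 : ContinuousOn (fun p : ℝ × ℝ => Real.sin (2 * p.2) ^ (-(gammaExp α / 2))) strip := by
    refine ContinuousOn.rpow_const (by fun_prop) fun p hp => Or.inl ?_
    exact (Real.sin_pos_of_pos_of_lt_pi (by linarith [hp.2.1]) (by linarith [hp.2.2])).ne'
  exact (h1.mul h2).congr fun p _ => rfl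

/-! ### Lemma 9.6 of Elgindi–Ghoul–Masmoudi in tail form -/

/-- **Radial multipliers, tail form of Lemma 9.6.** Let `c ∈ C^N(ℝ)` be radial with
`|Dz₁^l c| ≤ B` for `l ≤ j` and `c = 0` on `z < M`, `f ∈ C^N` of the open strip, `i + j ≤ N`, and
`ω` a weight continuous on the strip. Then
`‖D_θ^i D_z^j (cf) · ω‖²_{L²(strip)} ≤ (j+1)4^jB² ∑_{l ≤ j} ∫∫_{z ≥ M} |D_θ^i D_z^{j−l} f · ω|²`
(Leibniz formula, `D_θ` does not see `c`, Cauchy–Schwarz in the `j+1` summands,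
`(j choose l)² ≤ 4^j`; Elgindi–Ghoul–Masmoudi 2021, Lemma 9.6 and its proof, p. 20:
"`∫|D^j(fφ)|²W_{D^j} ≤ C_jC_φ ∑_{|β| ≤ j}|D^βf|²W_{D^β}`"). [cite: ElgindiGhoulMasmoudi2021, Lemma 9.6 (p. 20 of arXiv:1910.14071)] -/
theorem eL2Sq_iterate_radialMul_le {c : ℝ → ℝ} {f ω : ℝ → ℝ → ℝ} {N i j : ℕ} {B M : ℝ}
    (hc : ContDiff ℝ N c) (hf : ContDiffOn ℝ N (uncurry f) strip) (hij : i + j ≤ N)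
    (hB : ∀ l, l ≤ j → ∀ z, |Dz₁^[l] c z| ≤ B) (hc0 : ∀ z < M, c z = 0)
    (hω : ContinuousOn (uncurry ω) strip) :
    eL2Sq (fun z θ => Dθ^[i] (Dz^[j] (radialMul c f)) z θ * ω z θ) ≤
      ENNReal.ofReal (((j + 1 : ℕ) : ℝ) * (4 ^ j * B ^ 2)) * ∑ l ∈ range (j + 1),
        ∫⁻ p in tailSet M, ‖Dθ^[i] (Dz^[j - l] f) p.1 p.2 * ω p.1 p.2‖ₑ ^ 2 := by
  -- the dominating functions: the terms of the Leibniz formula, cut off to the tail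
  set G : ℕ → ℝ → ℝ → ℝ := fun l z θ =>
    if M ≤ z then Dθ^[i] (Dz^[j - l] f) z θ * ω z θ else 0 with hG
  have hGe : ∀ l, eL2Sq (G l) =
      ∫⁻ p in tailSet M, ‖Dθ^[i] (Dz^[j - l] f) p.1 p.2 * ω p.1 p.2‖ₑ ^ 2 := by
    intro l
    rw [lintegral_tailSet_eq_indicator]
    unfold eL2Sq
    refine lintegral_congr fun p => ?_
    by_cases h : M ≤ p.1
    · rw [indicator_of_mem (show p ∈ {q : ℝ × ℝ | M ≤ q.1} from h)]
      simp [hG, h]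
    · rw [indicator_of_notMem (show p ∉ {q : ℝ × ℝ | M ≤ q.1} from h)]
      simp [hG, h]
  have hGm : ∀ l ∈ range (j + 1), AEMeasurable (uncurry (G l)) (volume.restrict strip) := by
    intro l hl
    have hl' : l ≤ j := Nat.lt_succ_iff.mp (mem_range.mp hl)
    have hcont : ContinuousOn (fun q : ℝ × ℝ => Dθ^[i] (Dz^[j - l] f) q.1 q.2 * ω q.1 q.2) strip :=
      (continuousOn_iterate_Dθ_Dz hf (by omega)).mul hω
    have hm := (hcont.aemeasurable (μ := volume) measurableSet_strip).indicator
      (measurableSet_le measurable_const measurable_fst : MeasurableSet {q : ℝ × ℝ | M ≤ q.1})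
    refine hm.congr (ae_of_all _ fun q => ?_)
    by_cases h : M ≤ q.1
    · rw [indicator_of_mem (show q ∈ {q : ℝ × ℝ | M ≤ q.1} from h)]
      simp [hG, h, uncurry]
    · rw [indicator_of_notMem (show q ∉ {q : ℝ × ℝ | M ≤ q.1} from h)]
      simp [hG, h, uncurry]
  have hc0' : ∀ z ∈ Iio M, c z = 0 := fun z hz => hc0 z hz
  -- the pointwise domination on the strip
  have hpt : ∀ p ∈ strip, ((fun z θ => Dθ^[i] (Dz^[j] (radialMul c f)) z θ * ω z θ) p.1 p.2) ^ 2 ≤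
      (((j + 1 : ℕ) : ℝ) * (4 ^ j * B ^ 2)) * ∑ l ∈ range (j + 1), (G l p.1 p.2) ^ 2 := by
    intro p hp
    show (Dθ^[i] (Dz^[j] (radialMul c f)) p.1 p.2 * ω p.1 p.2) ^ 2 ≤ _
    rw [iterate_Dθ_Dz_radialMul hc hf hij p hp]
    by_cases hM : M ≤ p.1
    · have hGl : ∀ l, G l p.1 p.2 = Dθ^[i] (Dz^[j - l] f) p.1 p.2 * ω p.1 p.2 := fun l => by
        simp [hG, hM]
      calc ((∑ l ∈ range (j + 1), (j.choose l : ℝ) *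
              (Dz₁^[l] c p.1 * Dθ^[i] (Dz^[j - l] f) p.1 p.2)) * ω p.1 p.2) ^ 2
          = (∑ l ∈ range (j + 1), (j.choose l : ℝ) *
              (Dz₁^[l] c p.1 * Dθ^[i] (Dz^[j - l] f) p.1 p.2) * ω p.1 p.2) ^ 2 := by
            rw [Finset.sum_mul]
        _ ≤ (#(range (j + 1)) : ℝ) * ∑ l ∈ range (j + 1), ((j.choose l : ℝ) *
              (Dz₁^[l] c p.1 * Dθ^[i] (Dz^[j - l] f) p.1 p.2) * ω p.1 p.2) ^ 2 :=
            sq_sum_le_card_mul_sum_sq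
        _ ≤ ((j + 1 : ℕ) : ℝ) * ∑ l ∈ range (j + 1), (4 ^ j * B ^ 2) * (G l p.1 p.2) ^ 2 := by
            rw [Finset.card_range]
            refine mul_le_mul_of_nonneg_left (Finset.sum_le_sum fun l hl => ?_) (by positivity)
            have hl' : l ≤ j := Nat.lt_succ_iff.mp (mem_range.mp hl)
            rw [hGl l]
            have h1 : ((j.choose l : ℝ)) ^ 2 ≤ 4 ^ j := by
              have h2j : (j.choose l : ℝ) ≤ 2 ^ j := by exact_mod_cast Nat.choose_le_two_pow j l
              calc ((j.choose l : ℝ)) ^ 2 ≤ ((2 : ℝ) ^ j) ^ 2 := pow_le_pow_left₀ (by positivity) h2j 2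
                _ = 4 ^ j := by rw [← pow_mul, mul_comm, pow_mul]; norm_num
            have h2 : (Dz₁^[l] c p.1) ^ 2 ≤ B ^ 2 := by
              have hb := abs_le.1 (hB l hl' p.1)
              exact sq_le_sq' hb.1 hb.2
            calc ((j.choose l : ℝ) * (Dz₁^[l] c p.1 * Dθ^[i] (Dz^[j - l] f) p.1 p.2) * ω p.1 p.2) ^ 2
                = (j.choose l : ℝ) ^ 2 * (Dz₁^[l] c p.1) ^ 2 *
                    (Dθ^[i] (Dz^[j - l] f) p.1 p.2 * ω p.1 p.2) ^ 2 := by ring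
              _ ≤ 4 ^ j * B ^ 2 * (Dθ^[i] (Dz^[j - l] f) p.1 p.2 * ω p.1 p.2) ^ 2 := by
                  apply mul_le_mul_of_nonneg_right _ (sq_nonneg _)
                  exact mul_le_mul h1 h2 (sq_nonneg _) (by positivity)
        _ = (((j + 1 : ℕ) : ℝ) * (4 ^ j * B ^ 2)) * ∑ l ∈ range (j + 1), (G l p.1 p.2) ^ 2 := by
            rw [← Finset.mul_sum]
            ring
    · have h0 : ∀ l ∈ range (j + 1),
          (j.choose l : ℝ) * (Dz₁^[l] c p.1 * Dθ^[i] (Dz^[j - l] f) p.1 p.2) = 0 := by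
        intro l _
        rw [iterate_Dz₁_eq_zero_of_eqOn isOpen_Iio hc0' l p.1 (lt_of_not_ge hM)]
        ring
      rw [Finset.sum_eq_zero h0]
      simp only [zero_mul, ne_eq, OfNat.ofNat_ne_zero, not_false_eq_true, zero_pow]
      positivity
  calc eL2Sq (fun z θ => Dθ^[i] (Dz^[j] (radialMul c f)) z θ * ω z θ)
      ≤ ENNReal.ofReal (((j + 1 : ℕ) : ℝ) * (4 ^ j * B ^ 2)) * ∑ l ∈ range (j + 1), eL2Sq (G l) :=
        eL2Sq_le_of_sq_le_sum (range (j + 1)) (by positivity) hGm hpt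
    _ = _ := by simp_rw [hGe]

/-- **`|cf|²_{𝓗ᵏ} ≤ K(k, B) · E` when every tail term of `f` beyond `M` is `≤ E`**: the radial
multiplier estimate for the whole `𝓗ᵏ` functional, with a constant depending only on `k` and the
bound `B` on `Dz₁^l c`, `l ≤ k` (Elgindi–Ghoul–Masmoudi 2021, Lemma 9.6 with Remark 9.7/9.8). [cite: ElgindiGhoulMasmoudi2021, Lemma 9.6 (p. 20 of arXiv:1910.14071)] -/
theorem exists_eHkNormSq_radialMul_le (α : ℝ) (k : ℕ) (B : ℝ) :
    ∃ K : ℝ≥0∞, K ≠ ∞ ∧ ∀ (c : ℝ → ℝ) (f : ℝ → ℝ → ℝ) (M : ℝ) (E : ℝ≥0∞),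
      ContDiff ℝ k c → ContDiffOn ℝ k (uncurry f) strip →
      (∀ l, l ≤ k → ∀ z, |Dz₁^[l] c z| ≤ B) → (∀ z < M, c z = 0) →
      (∀ j, j ≤ k → ∫⁻ p in tailSet M, ‖hkRadialTerm j f p.1 p.2‖ₑ ^ 2 ≤ E) →
      (∀ i j, 1 ≤ i → i + j ≤ k → ∫⁻ p in tailSet M, ‖hkMixedTerm α i j f p.1 p.2‖ₑ ^ 2 ≤ E) →
      eHkNormSq α k (radialMul c f) ≤ K * E := by
  refine ⟨(((k + 1) + (k + 1) ^ 2 : ℕ) : ℝ≥0∞) *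
      (ENNReal.ofReal (((k + 1 : ℕ) : ℝ) * (4 ^ k * B ^ 2)) * ((k + 1 : ℕ) : ℝ≥0∞)),
    ENNReal.mul_ne_top (ENNReal.natCast_ne_top _)
      (ENNReal.mul_ne_top ENNReal.ofReal_ne_top (ENNReal.natCast_ne_top _)),
    fun c f M E hc hf hB hc0 hr hm => ?_⟩
  -- the constant of order `j` is bounded by the constant of order `k`
  have hconst : ∀ j, j ≤ k → ENNReal.ofReal (((j + 1 : ℕ) : ℝ) * (4 ^ j * B ^ 2)) ≤
      ENNReal.ofReal (((k + 1 : ℕ) : ℝ) * (4 ^ k * B ^ 2)) := by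
    intro j hj
    refine ENNReal.ofReal_le_ofReal (mul_le_mul ?_ ?_ (by positivity) (by positivity))
    · exact_mod_cast Nat.succ_le_succ hj
    · exact mul_le_mul_of_nonneg_right (pow_le_pow_right₀ (by norm_num) hj) (sq_nonneg _)
  have hsumE : ∀ j, j ≤ k → ∀ (T : ℕ → ℝ≥0∞), (∀ l ∈ range (j + 1), T l ≤ E) →
      ∑ l ∈ range (j + 1), T l ≤ ((k + 1 : ℕ) : ℝ≥0∞) * E := by
    intro j hj T hT
    calc ∑ l ∈ range (j + 1), T l ≤ #(range (j + 1)) • E := Finset.sum_le_card_nsmul _ _ _ hT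
      _ = ((j + 1 : ℕ) : ℝ≥0∞) * E := by rw [Finset.card_range, nsmul_eq_mul]
      _ ≤ ((k + 1 : ℕ) : ℝ≥0∞) * E := by
          refine mul_le_mul' ?_ le_rfl
          exact_mod_cast Nat.succ_le_succ hj
  rw [mul_assoc, mul_assoc]
  refine eHkNormSq_le_of_forall_le (fun j hj => ?_) (fun i j hi hij => ?_)
  · have h := eL2Sq_iterate_radialMul_le (i := 0) (ω := hWeight) (M := M) hc hf (by omega)
      (fun l hl => hB l (hl.trans hj)) hc0 continuousOn_hWeight
    calc eL2Sq (hkRadialTerm j (radialMul c f))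
        = eL2Sq (fun z θ => Dθ^[0] (Dz^[j] (radialMul c f)) z θ * hWeight z θ) := rfl
      _ ≤ _ := h
      _ ≤ ENNReal.ofReal (((k + 1 : ℕ) : ℝ) * (4 ^ k * B ^ 2)) * (((k + 1 : ℕ) : ℝ≥0∞) * E) := by
          refine mul_le_mul' (hconst j hj) (hsumE j hj _ fun l hl => ?_)
          have hl' : l ≤ j := Nat.lt_succ_iff.mp (mem_range.mp hl)
          exact hr (j - l) (by omega)
  · have hjk : j ≤ k := by omega
    have h := eL2Sq_iterate_radialMul_le (i := i) (ω := totalWeight α) (M := M) hc hf hij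
      (fun l hl => hB l (hl.trans hjk)) hc0 (continuousOn_totalWeight α)
    calc eL2Sq (hkMixedTerm α i j (radialMul c f))
        = eL2Sq (fun z θ => Dθ^[i] (Dz^[j] (radialMul c f)) z θ * totalWeight α z θ) := rfl
      _ ≤ _ := h
      _ ≤ ENNReal.ofReal (((k + 1 : ℕ) : ℝ) * (4 ^ k * B ^ 2)) * (((k + 1 : ℕ) : ℝ≥0∞) * E) := by
          refine mul_le_mul' (hconst j hjk) (hsumE j hjk _ fun l hl => ?_)
          have hl' : l ≤ j := Nat.lt_succ_iff.mp (mem_range.mp hl)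
          exact hm i (j - l) hi (by omega)

/-! ### The quasi-triangle inequality for the `𝓗ᵏ` functional -/

/-- **`|f + g|²_{𝓗ᵏ} ≤ 2|f|²_{𝓗ᵏ} + 2|g|²_{𝓗ᵏ}`** for `f, g ∈ Cᵏ` of the open strip (term by term,
`(x + y)² ≤ 2x² + 2y²`, the `D`-iterates being additive on the strip). [folklore] -/
theorem eHkNormSq_add_le {α : ℝ} {k : ℕ} {f₁ f₂ : ℝ → ℝ → ℝ} (hf₁ : ContDiffOn ℝ k (uncurry f₁) strip)
    (hf₂ : ContDiffOn ℝ k (uncurry f₂) strip) :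
    eHkNormSq α k (f₁ + f₂) ≤ 2 * eHkNormSq α k f₁ + 2 * eHkNormSq α k f₂ := by
  have hterm : ∀ (i j : ℕ) (ω : ℝ → ℝ → ℝ), i + j ≤ k → ContinuousOn (uncurry ω) strip →
      eL2Sq (fun z θ => Dθ^[i] (Dz^[j] (f₁ + f₂)) z θ * ω z θ) ≤
        2 * eL2Sq (fun z θ => Dθ^[i] (Dz^[j] f₁) z θ * ω z θ) +
          2 * eL2Sq (fun z θ => Dθ^[i] (Dz^[j] f₂) z θ * ω z θ) := by
    intro i j ω hij hω
    have h1 : AEMeasurable (uncurry fun z θ => Dθ^[i] (Dz^[j] f₁) z θ * ω z θ)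
        (volume.restrict strip) :=
      ((continuousOn_iterate_Dθ_Dz hf₁ hij).mul hω).aemeasurable measurableSet_strip
    have h := eL2Sq_le_of_sq_le_add (g := fun z θ => Dθ^[i] (Dz^[j] (f₁ + f₂)) z θ * ω z θ)
      (G₁ := fun z θ => Dθ^[i] (Dz^[j] f₁) z θ * ω z θ)
      (G₂ := fun z θ => Dθ^[i] (Dz^[j] f₂) z θ * ω z θ) (A := 2) (B := 2)
      (by norm_num) (by norm_num) h1 (fun p hp => ?_)
    · simpa using h
    · show (Dθ^[i] (Dz^[j] (f₁ + f₂)) p.1 p.2 * ω p.1 p.2) ^ 2 ≤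
        2 * (Dθ^[i] (Dz^[j] f₁) p.1 p.2 * ω p.1 p.2) ^ 2 +
          2 * (Dθ^[i] (Dz^[j] f₂) p.1 p.2 * ω p.1 p.2) ^ 2
      rw [iterate_Dθ_Dz_add hf₁ hf₂ hij p hp]
      nlinarith [sq_nonneg ((Dθ^[i] (Dz^[j] f₁) p.1 p.2 - Dθ^[i] (Dz^[j] f₂) p.1 p.2) * ω p.1 p.2)]
  have hr : ∀ j ∈ range (k + 1), eL2Sq (hkRadialTerm j (f₁ + f₂)) ≤
      2 * eL2Sq (hkRadialTerm j f₁) + 2 * eL2Sq (hkRadialTerm j f₂) := fun j hj =>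
    hterm 0 j hWeight (by have := mem_range.mp hj; omega) continuousOn_hWeight
  have hm : ∀ i ∈ range (k + 1), ∀ j ∈ range (k + 1),
      (if 1 ≤ i ∧ i + j ≤ k then eL2Sq (hkMixedTerm α i j (f₁ + f₂)) else 0) ≤
        2 * (if 1 ≤ i ∧ i + j ≤ k then eL2Sq (hkMixedTerm α i j f₁) else 0) +
          2 * (if 1 ≤ i ∧ i + j ≤ k then eL2Sq (hkMixedTerm α i j f₂) else 0) := by
    intro i _ j _
    split_ifs with h
    · exact hterm i j (totalWeight α) h.2 (continuousOn_totalWeight α)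
    · simp
  unfold eHkNormSq
  calc (∑ j ∈ range (k + 1), eL2Sq (hkRadialTerm j (f₁ + f₂))) +
        ∑ i ∈ range (k + 1), ∑ j ∈ range (k + 1),
          (if 1 ≤ i ∧ i + j ≤ k then eL2Sq (hkMixedTerm α i j (f₁ + f₂)) else 0)
      ≤ (∑ j ∈ range (k + 1), (2 * eL2Sq (hkRadialTerm j f₁) + 2 * eL2Sq (hkRadialTerm j f₂))) +
        ∑ i ∈ range (k + 1), ∑ j ∈ range (k + 1),
          (2 * (if 1 ≤ i ∧ i + j ≤ k then eL2Sq (hkMixedTerm α i j f₁) else 0) +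
            2 * (if 1 ≤ i ∧ i + j ≤ k then eL2Sq (hkMixedTerm α i j f₂) else 0)) :=
        add_le_add (Finset.sum_le_sum hr)
          (Finset.sum_le_sum fun i hi => Finset.sum_le_sum fun j hj => hm i hi j hj)
    _ = _ := by
        simp only [Finset.sum_add_distrib, ← Finset.mul_sum]
        ring

/-! ### Tails of the `𝓗ᵏ` terms and the cut-off part -/

/-- **Tails are eventually uniformly small**: if every term of `|f|²_{𝓗ᵏ}` has a finite integral
over `z ≥ 1`, then for `ε > 0` and all large `M`, every term has integral `≤ ε` over `z ≥ M`. [folklore] -/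
theorem eventually_tails_le {α : ℝ} {k : ℕ} {f : ℝ → ℝ → ℝ}
    (hr : ∀ j, j ≤ k → ∫⁻ p in tailSet 1, ‖hkRadialTerm j f p.1 p.2‖ₑ ^ 2 ≠ ∞)
    (hm : ∀ i j, 1 ≤ i → i + j ≤ k → ∫⁻ p in tailSet 1, ‖hkMixedTerm α i j f p.1 p.2‖ₑ ^ 2 ≠ ∞)
    {ε : ℝ≥0∞} (hε : 0 < ε) :
    ∀ᶠ M in atTop, (∀ j, j ≤ k → ∫⁻ p in tailSet M, ‖hkRadialTerm j f p.1 p.2‖ₑ ^ 2 ≤ ε) ∧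
      (∀ i j, 1 ≤ i → i + j ≤ k → ∫⁻ p in tailSet M, ‖hkMixedTerm α i j f p.1 p.2‖ₑ ^ 2 ≤ ε) := by
  have hr' : ∀ j ∈ range (k + 1), ∀ᶠ M in atTop,
      ∫⁻ p in tailSet M, ‖hkRadialTerm j f p.1 p.2‖ₑ ^ 2 ≤ ε := by
    intro j hj
    obtain ⟨M₀, -, hM₀⟩ :=
      exists_lintegral_tailSet_le (hr j (Nat.lt_succ_iff.mp (mem_range.mp hj))) hε
    exact eventually_atTop.2 ⟨M₀, hM₀⟩
  have hm' : ∀ ij ∈ range (k + 1) ×ˢ range (k + 1), ∀ᶠ M in atTop,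
      (1 ≤ ij.1 → ij.1 + ij.2 ≤ k →
        ∫⁻ p in tailSet M, ‖hkMixedTerm α ij.1 ij.2 f p.1 p.2‖ₑ ^ 2 ≤ ε) := by
    intro ij _
    by_cases h : 1 ≤ ij.1 ∧ ij.1 + ij.2 ≤ k
    · obtain ⟨M₀, -, hM₀⟩ := exists_lintegral_tailSet_le (hm ij.1 ij.2 h.1 h.2) hε
      exact eventually_atTop.2 ⟨M₀, fun M hM _ _ => hM₀ M hM⟩
    · exact Eventually.of_forall fun M h1 h2 => absurd ⟨h1, h2⟩ h
  filter_upwards [(Filter.eventually_all_finset _).2 hr', (Filter.eventually_all_finset _).2 hm']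
    with M h1 h2
  refine ⟨fun j hj => h1 j (mem_range.2 (Nat.lt_succ_of_le hj)), fun i j hi hij => ?_⟩
  exact h2 (i, j) (Finset.mem_product.2 ⟨mem_range.2 (by omega), mem_range.2 (by omega)⟩) hi hij

/-- **The cut-off part is `𝓗ᵏ`-small**: `|tailCut M · f|²_{𝓗ᵏ} → 0` as `M → ∞` for `f ∈ Cᵏ` of the
open strip all of whose `𝓗ᵏ` terms have finite integral over `z ≥ 1` (Elgindi–Ghoul–Masmoudi 2021,
§2.6: `‖(χ(z/M) − 1)F‖_{𝓗ᵏ} ≤ C/M^{1/4} + Cα²`, in qualitative form). [cite: ElgindiGhoulMasmoudi2021, §2.6 (p. 9 of arXiv:1910.14071)] -/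
theorem tendsto_eHkNormSq_tailCut_radialMul {α : ℝ} {k : ℕ} {f : ℝ → ℝ → ℝ}
    (hf : ContDiffOn ℝ k (uncurry f) strip)
    (hr : ∀ j, j ≤ k → ∫⁻ p in tailSet 1, ‖hkRadialTerm j f p.1 p.2‖ₑ ^ 2 ≠ ∞)
    (hm : ∀ i j, 1 ≤ i → i + j ≤ k → ∫⁻ p in tailSet 1, ‖hkMixedTerm α i j f p.1 p.2‖ₑ ^ 2 ≠ ∞) :
    Tendsto (fun M : ℝ => eHkNormSq α k (radialMul (tailCut M) f)) atTop (𝓝 0) := by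
  obtain ⟨B, -, hB⟩ := exists_abs_iterate_Dz₁_tailCut_le k
  obtain ⟨K, hK, hKle⟩ := exists_eHkNormSq_radialMul_le α k B
  rw [ENNReal.tendsto_nhds_zero]
  intro ε hε
  have hε' : 0 < ε / K := ENNReal.div_pos hε.ne' hK
  filter_upwards [eventually_tails_le hr hm hε', eventually_gt_atTop (0 : ℝ)] with M hM hM0
  calc eHkNormSq α k (radialMul (tailCut M) f) ≤ K * (ε / K) :=
        hKle (tailCut M) f M (ε / K) (contDiff_tailCut M k) hf (fun l hl z => hB M l hl z)
          (fun z hz => tailCut_of_le hM0 hz.le) hM.1 hM.2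
    _ ≤ ε := ENNReal.mul_div_le

/-- **`a_M = L₁₂(tailCut M · g)(0) → 0`** as `M → ∞` whenever `g K/r` is integrable on the strip
(the integrand is dominated by `|g K/r|` cut off to `z ≥ M`; Elgindi–Ghoul–Masmoudi 2021, §2.6:
`|a_M| ≤ C/M + Cα²`, in qualitative form). [cite: ElgindiGhoulMasmoudi2021, §2.6 (p. 9 of arXiv:1910.14071)] -/
theorem tendsto_L12_tailCut_radialMul {g : ℝ → ℝ → ℝ} (hg : IntegrableOn (l12Integrand g) strip) :
    Tendsto (fun M : ℝ => L12 (radialMul (tailCut M) g) 0) atTop (𝓝 0) := by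
  have hfin : ∫⁻ p in tailSet 1, ‖l12Integrand g p‖ₑ ≠ ∞ :=
    ne_top_of_le_ne_top hg.2.ne (lintegral_tailSet_le _ 1)
  rw [Metric.tendsto_atTop]
  intro ε hε
  obtain ⟨M₀, hM₀1, hM₀⟩ := exists_lintegral_tailSet_le hfin (ENNReal.ofReal_pos.2 (half_pos hε))
  refine ⟨M₀, fun M hM => ?_⟩
  have hM0 : 0 < M := lt_of_lt_of_le one_pos (hM₀1.trans hM)
  have hint : IntegrableOn (l12Integrand (radialMul (tailCut M) g)) strip :=
    integrableOn_l12Integrand_radialMul (continuous_tailCut M) (abs_tailCut_le_one M) hg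
  have h2 : ∫⁻ p in strip, ‖l12Integrand (radialMul (tailCut M) g) p‖ₑ ≤
      ∫⁻ p in tailSet M, ‖l12Integrand g p‖ₑ := by
    rw [lintegral_tailSet_eq_indicator]
    refine lintegral_mono fun p => ?_
    by_cases h : M ≤ p.1
    · rw [indicator_of_mem (show p ∈ {q : ℝ × ℝ | M ≤ q.1} from h)]
      simp only [l12Integrand_apply, radialMul_apply]
      rw [show tailCut M p.1 * g p.1 p.2 * kernelK p.2 / p.1 =
        tailCut M p.1 * (g p.1 p.2 * kernelK p.2 / p.1) by ring, enorm_mul]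
      have h1 : ‖tailCut M p.1‖ₑ ≤ 1 := by
        rw [Real.enorm_eq_ofReal_abs, ← ENNReal.ofReal_one]
        exact ENNReal.ofReal_le_ofReal (abs_tailCut_le_one M p.1)
      calc ‖tailCut M p.1‖ₑ * ‖g p.1 p.2 * kernelK p.2 / p.1‖ₑ
          ≤ 1 * ‖g p.1 p.2 * kernelK p.2 / p.1‖ₑ := mul_le_mul' h1 le_rfl
        _ = _ := one_mul _
    · rw [indicator_of_notMem (show p ∉ {q : ℝ × ℝ | M ≤ q.1} from h)]
      simp [l12Integrand_apply, radialMul_apply, tailCut_of_le hM0 (le_of_not_ge h)]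
  have hne : ∫⁻ p in tailSet M, ‖l12Integrand g p‖ₑ ≠ ∞ :=
    ne_top_of_le_ne_top ENNReal.ofReal_ne_top (hM₀ M hM)
  rw [Real.dist_0_eq_abs]
  calc |L12 (radialMul (tailCut M) g) 0|
      ≤ (∫⁻ p in strip, ‖l12Integrand (radialMul (tailCut M) g) p‖ₑ).toReal := abs_L12_zero_le hint
    _ ≤ (∫⁻ p in tailSet M, ‖l12Integrand g p‖ₑ).toReal := ENNReal.toReal_mono hne h2
    _ ≤ (ENNReal.ofReal (ε / 2)).toReal := ENNReal.toReal_mono ENNReal.ofReal_ne_top (hM₀ M hM)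
    _ = ε / 2 := ENNReal.toReal_ofReal (by positivity)
    _ < ε := half_lt_self hε

/-! ### The bump `σ(z) F_*(z, θ)` -/

/-- `L₁₂(σF_*)(0) = ∫₀^∞ σ(r) · 4α/(1+r)² dr` (the angular integral of `F_* K/r` is `4α/(1+r)²`). [folklore] -/
theorem L12_bumpRadial_mul_fundamentalProfile {α : ℝ} (hα : 0 ≤ α) :
    L12 (radialMul bumpRadial (fundamentalProfile α)) 0 =
      ∫ r in Ioi (0 : ℝ), bumpRadial r * (4 * α / (1 + r) ^ 2) := by
  rw [L12_def]
  refine setIntegral_congr_fun measurableSet_Ioi fun r hr => ?_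
  have hr0 : r ≠ 0 := ne_of_gt hr
  rw [← integral_fundamentalProfile_mul_kernelK_div hα hr0, ← integral_const_mul]
  congr 1
  funext θ
  simp only [radialMul_apply]
  ring

/-- **`b = L₁₂(σF_*)(0) > 0`** (the integrand `σ(r) · 4α/(1+r)²` is nonnegative, continuous,
integrable, and positive on `(1, 4)`; Elgindi–Ghoul–Masmoudi 2021, §2.6: "the fixed constant
`b = L₁₂(sin(2θ)χ((z−3)²))(0) > 0`"). [cite: ElgindiGhoulMasmoudi2021, §2.6 (p. 9 of arXiv:1910.14071)] -/
theorem L12_bumpRadial_mul_fundamentalProfile_pos {α : ℝ} (hα : 0 < α) :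
    0 < L12 (radialMul bumpRadial (fundamentalProfile α)) 0 := by
  rw [L12_bumpRadial_mul_fundamentalProfile hα.le]
  have hint : IntegrableOn (fun r : ℝ => bumpRadial r * (4 * α / (1 + r) ^ 2)) (Ioi 0) := by
    have h0 : IntegrableOn (fun r : ℝ => 4 * α * ((1 + r) ^ 2)⁻¹) (Ioi 0) :=
      integrableOn_inv_one_add_sq.const_mul (4 * α)
    have h1 := Integrable.bdd_mul h0 continuous_bumpRadial.aestronglyMeasurable
      (ae_of_all _ fun r => (Real.norm_eq_abs _).le.trans (abs_bumpRadial_le_one r))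
    refine IntegrableOn.congr_fun h1 (fun r _ => ?_) measurableSet_Ioi
    simp only [div_eq_mul_inv]
  have hnn : 0 ≤ᵐ[volume.restrict (Ioi (0 : ℝ))] fun r : ℝ => bumpRadial r * (4 * α / (1 + r) ^ 2) :=
    ae_of_all _ fun r => mul_nonneg (bumpRadial_nonneg r) (div_nonneg (by positivity) (sq_nonneg _))
  rw [integral_pos_iff_support_of_nonneg_ae hnn hint, Measure.restrict_apply' measurableSet_Ioi]
  have hsub : Ioo (1 : ℝ) 4 ⊆
      (support fun r : ℝ => bumpRadial r * (4 * α / (1 + r) ^ 2)) ∩ Ioi 0 := by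
    intro r hr
    refine ⟨?_, lt_trans one_pos hr.1⟩
    rw [mem_support]
    have h1 : 0 < bumpRadial r := bumpRadial_pos hr
    have h2 : 0 < 4 * α / (1 + r) ^ 2 := by
      have : 0 < 1 + r := by linarith [hr.1]
      positivity
    exact (mul_pos h1 h2).ne'
  calc (0 : ℝ≥0∞) < volume (Ioo (1 : ℝ) 4) := by simp [Real.volume_Ioo]
    _ ≤ _ := measure_mono hsub

/-- **`|σF_*|²_{𝓗ᵏ} < ∞`**: the bump has a finite `𝓗ᵏ` functional (radial multiplier estimate
with `σ = 0` on `z < 1` and the finite `z ≥ 1` tails of `F_*`). [folklore] -/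
theorem eHkNormSq_bumpRadial_mul_fundamentalProfile_ne_top {α : ℝ} (hα : 0 < α) (k : ℕ) :
    eHkNormSq α k (radialMul bumpRadial (fundamentalProfile α)) ≠ ∞ := by
  obtain ⟨B, -, hB⟩ := exists_abs_iterate_Dz₁_bumpRadial_le k
  obtain ⟨K, hK, hKle⟩ := exists_eHkNormSq_radialMul_le α k B
  set E : ℝ≥0∞ :=
    (∑ j ∈ range (k + 1), ∫⁻ p in tailSet 1, ‖hkRadialTerm j (fundamentalProfile α) p.1 p.2‖ₑ ^ 2) +
      ∑ i ∈ range (k + 1), ∑ j ∈ range (k + 1),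
        ∫⁻ p in tailSet 1, ‖hkMixedTerm α i j (fundamentalProfile α) p.1 p.2‖ₑ ^ 2 with hE
  have hEfin : E ≠ ∞ := by
    refine ENNReal.add_ne_top.2 ⟨?_, ?_⟩
    · exact ENNReal.sum_ne_top.2 fun j _ =>
        (lintegral_tailSet_one_hkRadialTerm_fundamentalProfile_lt_top hα j).ne
    · exact ENNReal.sum_ne_top.2 fun i _ => ENNReal.sum_ne_top.2 fun j _ =>
        (lintegral_tailSet_one_hkMixedTerm_fundamentalProfile_lt_top hα i j).ne
  have hr : ∀ j, j ≤ k →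
      ∫⁻ p in tailSet 1, ‖hkRadialTerm j (fundamentalProfile α) p.1 p.2‖ₑ ^ 2 ≤ E := by
    intro j hj
    refine le_trans ?_ le_self_add
    exact Finset.single_le_sum (f := fun j =>
      ∫⁻ p in tailSet 1, ‖hkRadialTerm j (fundamentalProfile α) p.1 p.2‖ₑ ^ 2)
      (fun _ _ => zero_le) (mem_range.2 (by omega))
  have hm : ∀ i j, 1 ≤ i → i + j ≤ k →
      ∫⁻ p in tailSet 1, ‖hkMixedTerm α i j (fundamentalProfile α) p.1 p.2‖ₑ ^ 2 ≤ E := by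
    intro i j hi hij
    have h1 : ∫⁻ p in tailSet 1, ‖hkMixedTerm α i j (fundamentalProfile α) p.1 p.2‖ₑ ^ 2 ≤
        ∑ j' ∈ range (k + 1),
          ∫⁻ p in tailSet 1, ‖hkMixedTerm α i j' (fundamentalProfile α) p.1 p.2‖ₑ ^ 2 :=
      Finset.single_le_sum (f := fun j' =>
        ∫⁻ p in tailSet 1, ‖hkMixedTerm α i j' (fundamentalProfile α) p.1 p.2‖ₑ ^ 2)
        (fun _ _ => zero_le) (mem_range.2 (show j < k + 1 by omega))
    have h2 : ∑ j' ∈ range (k + 1),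
          ∫⁻ p in tailSet 1, ‖hkMixedTerm α i j' (fundamentalProfile α) p.1 p.2‖ₑ ^ 2 ≤
        ∑ i' ∈ range (k + 1), ∑ j' ∈ range (k + 1),
          ∫⁻ p in tailSet 1, ‖hkMixedTerm α i' j' (fundamentalProfile α) p.1 p.2‖ₑ ^ 2 :=
      Finset.single_le_sum (f := fun i' => ∑ j' ∈ range (k + 1),
        ∫⁻ p in tailSet 1, ‖hkMixedTerm α i' j' (fundamentalProfile α) p.1 p.2‖ₑ ^ 2)
        (fun _ _ => zero_le) (mem_range.2 (show i < k + 1 by omega))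
    exact (h1.trans h2).trans le_add_self
  have h := hKle bumpRadial (fundamentalProfile α) 1 E (contDiff_bumpRadial k)
    (contDiffOn_fundamentalProfile α) (fun l hl z => hB l hl z)
    (fun z hz => bumpRadial_of_le_one hz.le) hr hm
  exact ne_top_of_le_ne_top (ENNReal.mul_ne_top hK hEfin) h

/-! ### The §2.6 datum -/

/-- **Elgindi–Ghoul–Masmoudi's compactly supported datum (discharge of the named fact
`ElgindiGhoulMasmoudi2021_compactSupportDatum`).** For `α > 0`, an amplitude `a`, a function `F`
of class `C⁴` in the open quarter strip with `|F − aF_*|_{𝓗⁴} < ∞`, and `τ > 0`, the data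
`ε_M = (χ(z/M) − 1)F + β_M σF_*` with `β_M = −L₁₂((χ(z/M) − 1)F)(0)/L₁₂(σF_*)(0)` are `C⁴` in the
open strip, have `L₁₂(ε_M)(0) = 0`, make `F + ε_M` vanish for `z ≥ 2M`, and `|ε_M|_{𝓗⁴} → 0` as
`M → ∞`; so some `ε_M` has `|ε_M|_{𝓗⁴} < τ` (Camb. J. Math. 9 (2021) = arXiv:1910.14071, §2.6,
p. 9, with Lemma 9.6 and Remark 9.8, p. 20; see the module docstring for the rendering of the
bump). [cite: ElgindiGhoulMasmoudi2021, §2.6 (p. 9 of arXiv:1910.14071); Lemma 9.6 and Remark 9.8 (p. 20)] -/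
theorem ElgindiGhoulMasmoudi2021_compactSupportDatum_holds :
    ElgindiGhoulMasmoudi2021_compactSupportDatum := by
  intro α hα a F hF hFa τ hτ
  -- the players
  set h : ℝ → ℝ → ℝ := F - a • fundamentalProfile α with hh
  set b : ℝ → ℝ → ℝ := radialMul bumpRadial (fundamentalProfile α) with hb
  have hh4 : ContDiffOn ℝ 4 (uncurry h) strip := contDiffOn_sub_smul_fundamentalProfile hF a
  have hP4 : ContDiffOn ℝ 4 (uncurry (fundamentalProfile α)) strip := contDiffOn_fundamentalProfile α
  have hb4 : ContDiffOn ℝ 4 (uncurry b) strip := contDiffOn_radialMul (contDiff_bumpRadial 4) hP4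
  have hhfin : eHkNormSq α 4 h ≠ ∞ := by
    intro htop
    apply hFa
    show eHkNormSq α 4 h ^ (1 / 2 : ℝ) = ∞
    rw [htop, ENNReal.top_rpow_of_pos (by norm_num)]
  -- (1) the `𝓗⁴` functional of the cut-off part tends to `0`
  have hT1 : Tendsto (fun M : ℝ => eHkNormSq α 4 (radialMul (tailCut M) (fundamentalProfile α)))
      atTop (𝓝 0) :=
    tendsto_eHkNormSq_tailCut_radialMul hP4
      (fun j _ => (lintegral_tailSet_one_hkRadialTerm_fundamentalProfile_lt_top hα j).ne)
      (fun i j _ _ => (lintegral_tailSet_one_hkMixedTerm_fundamentalProfile_lt_top hα i j).ne)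
  have hT2 : Tendsto (fun M : ℝ => eHkNormSq α 4 (radialMul (tailCut M) h)) atTop (𝓝 0) :=
    tendsto_eHkNormSq_tailCut_radialMul hh4
      (fun j hj => ne_top_of_le_ne_top hhfin
        ((lintegral_tailSet_le _ 1).trans (eL2Sq_hkRadialTerm_le α hj h)))
      (fun i j hi hij => ne_top_of_le_ne_top hhfin
        ((lintegral_tailSet_le _ 1).trans (eL2Sq_hkMixedTerm_le α hi hij h)))
  have hTF : Tendsto (fun M : ℝ => eHkNormSq α 4 (radialMul (tailCut M) F)) atTop (𝓝 0) := by
    have hle : ∀ M, eHkNormSq α 4 (radialMul (tailCut M) F) ≤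
        2 * (‖a‖ₑ ^ 2 * eHkNormSq α 4 (radialMul (tailCut M) (fundamentalProfile α))) +
          2 * eHkNormSq α 4 (radialMul (tailCut M) h) := by
      intro M
      have e : radialMul (tailCut M) F =
          a • radialMul (tailCut M) (fundamentalProfile α) + radialMul (tailCut M) h := by
        funext z θ
        simp only [radialMul_apply, Pi.add_apply, Pi.smul_apply, smul_eq_mul, hh, Pi.sub_apply]
        ring
      rw [e]
      have h1 : ContDiffOn ℝ 4 (uncurry (a • radialMul (tailCut M) (fundamentalProfile α))) strip :=
        ((contDiffOn_radialMul (contDiff_tailCut M 4) hP4).const_smul a).congr fun p _ => rfl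
      have h2 : ContDiffOn ℝ 4 (uncurry (radialMul (tailCut M) h)) strip :=
        contDiffOn_radialMul (contDiff_tailCut M 4) hh4
      calc _ ≤ 2 * eHkNormSq α 4 (a • radialMul (tailCut M) (fundamentalProfile α)) +
            2 * eHkNormSq α 4 (radialMul (tailCut M) h) := eHkNormSq_add_le h1 h2
        _ = _ := by rw [eHkNormSq_smul]
    have hlim : Tendsto (fun M : ℝ =>
        2 * (‖a‖ₑ ^ 2 * eHkNormSq α 4 (radialMul (tailCut M) (fundamentalProfile α))) +
          2 * eHkNormSq α 4 (radialMul (tailCut M) h)) atTop (𝓝 0) := by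
      have ha : ‖a‖ₑ ^ 2 ≠ ∞ := ENNReal.pow_ne_top enorm_ne_top
      have h1 := ENNReal.Tendsto.const_mul (ENNReal.Tendsto.const_mul hT1 (Or.inr ha))
        (Or.inr ENNReal.ofNat_ne_top) (a := 2)
      have h2 := ENNReal.Tendsto.const_mul hT2 (Or.inr ENNReal.ofNat_ne_top) (a := 2)
      simpa using h1.add h2
    exact tendsto_of_tendsto_of_tendsto_of_le_of_le tendsto_const_nhds hlim (fun _ => zero_le) hle
  -- (2) `a_M = L₁₂(tailCut M · F)(0) → 0`
  have hFint : IntegrableOn (l12Integrand F) strip := by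
    have h1 : IntegrableOn (l12Integrand (fun z θ => a * fundamentalProfile α z θ)) strip :=
      integrableOn_l12Integrand_radialMul continuous_const (fun _ => le_rfl)
        (integrableOn_l12Integrand_fundamentalProfile hα.le)
    have h2 : IntegrableOn (l12Integrand h) strip :=
      integrableOn_l12Integrand_of_eL2Sq hh4.continuousOn
        (ne_top_of_le_ne_top hhfin (eL2Sq_hkRadialTerm_le α (Nat.zero_le 4) h))
    have e : l12Integrand F = fun p =>
        l12Integrand (fun z θ => a * fundamentalProfile α z θ) p + l12Integrand h p := by
      funext p
      simp only [l12Integrand_apply, hh, Pi.sub_apply, Pi.smul_apply, smul_eq_mul]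
      ring
    rw [e]
    exact h1.add h2
  have hA : Tendsto (fun M : ℝ => L12 (radialMul (tailCut M) F) 0) atTop (𝓝 0) :=
    tendsto_L12_tailCut_radialMul hFint
  -- (3) the bump
  have hBpos : 0 < L12 b 0 := L12_bumpRadial_mul_fundamentalProfile_pos hα
  have hbfin : eHkNormSq α 4 b ≠ ∞ := eHkNormSq_bumpRadial_mul_fundamentalProfile_ne_top hα 4
  have hbint : IntegrableOn (l12Integrand b) strip :=
    integrableOn_l12Integrand_radialMul continuous_bumpRadial abs_bumpRadial_le_one
      (integrableOn_l12Integrand_fundamentalProfile hα.le)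
  -- the data `ε_M = tailCut M · F + β_M b`, `β_M = −a_M / L₁₂(b)(0)`
  set β : ℝ → ℝ := fun M => -L12 (radialMul (tailCut M) F) 0 / L12 b 0 with hβ
  set ε : ℝ → ℝ → ℝ → ℝ := fun M => radialMul (tailCut M) F + β M • b with hε
  have hβlim : Tendsto β atTop (𝓝 0) := by
    have := (hA.neg).div_const (L12 b 0)
    simpa [hβ] using this
  have hεle : ∀ M, eHkNormSq α 4 (ε M) ≤
      2 * eHkNormSq α 4 (radialMul (tailCut M) F) + 2 * (‖β M‖ₑ ^ 2 * eHkNormSq α 4 b) := by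
    intro M
    have h1 : ContDiffOn ℝ 4 (uncurry (radialMul (tailCut M) F)) strip :=
      contDiffOn_radialMul (contDiff_tailCut M 4) hF
    have h2 : ContDiffOn ℝ 4 (uncurry (β M • b)) strip := (hb4.const_smul (β M)).congr fun p _ => rfl
    calc eHkNormSq α 4 (ε M)
        ≤ 2 * eHkNormSq α 4 (radialMul (tailCut M) F) + 2 * eHkNormSq α 4 (β M • b) :=
          eHkNormSq_add_le h1 h2
      _ = _ := by rw [eHkNormSq_smul]
  have hεlim : Tendsto (fun M => eHkNormSq α 4 (ε M)) atTop (𝓝 0) := by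
    have hβe : Tendsto (fun M => ‖β M‖ₑ ^ 2) atTop (𝓝 0) := by
      have h1 : Tendsto (fun M => ‖β M‖ₑ) atTop (𝓝 0) := by
        have := (continuous_enorm.tendsto (0 : ℝ)).comp hβlim
        simpa [Function.comp_def] using this
      have := ((ENNReal.continuous_pow 2).tendsto 0).comp h1
      simpa [Function.comp_def] using this
    have h2 : Tendsto (fun M => 2 * (‖β M‖ₑ ^ 2 * eHkNormSq α 4 b)) atTop (𝓝 0) := by
      have := ENNReal.Tendsto.const_mul (ENNReal.Tendsto.mul_const hβe (Or.inr hbfin))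
        (Or.inr ENNReal.ofNat_ne_top) (a := 2)
      simpa using this
    have h1 : Tendsto (fun M => 2 * eHkNormSq α 4 (radialMul (tailCut M) F)) atTop (𝓝 0) := by
      simpa using ENNReal.Tendsto.const_mul hTF (Or.inr ENNReal.ofNat_ne_top) (a := 2)
    refine tendsto_of_tendsto_of_tendsto_of_le_of_le tendsto_const_nhds ?_ (fun _ => zero_le) hεle
    simpa using h1.add h2
  -- choose `M`
  have h0 : (0 : ℝ≥0∞) < ENNReal.ofReal (τ ^ 2) := ENNReal.ofReal_pos.2 (by positivity)
  obtain ⟨M, hM, hM4⟩ := ((hεlim.eventually (gt_mem_nhds h0)).and (eventually_ge_atTop 4)).exists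
  have hM0 : 0 < M := by linarith
  refine ⟨ε M, ?_, eHkNorm_lt_of_sq_lt hτ hM, ?_, 2 * M, fun z θ hz _ => ?_⟩
  · -- `C⁴` in the open strip
    have h1 : ContDiffOn ℝ 4 (uncurry (radialMul (tailCut M) F)) strip :=
      contDiffOn_radialMul (contDiff_tailCut M 4) hF
    exact (h1.add (hb4.const_smul (β M))).congr fun p _ => rfl
  · -- `L₁₂(ε_M)(0) = a_M + β_M L₁₂(b)(0) = 0`
    have hint1 : IntegrableOn (l12Integrand (radialMul (tailCut M) F)) strip :=
      integrableOn_l12Integrand_radialMul (continuous_tailCut M) (abs_tailCut_le_one M) hFint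
    have hint2 : IntegrableOn (l12Integrand (β M • b)) strip :=
      integrableOn_l12Integrand_radialMul continuous_const (fun _ => le_rfl) hbint
    show L12 (radialMul (tailCut M) F + β M • b) 0 = 0
    rw [L12_zero_add hint1 hint2, L12_smul]
    simp only [hβ]
    field_simp
    ring
  · -- `F + ε_M = 0` for `z ≥ 2M` (`tailCut M = −1`, `σ = 0` there)
    show F z θ + (tailCut M z * F z θ + β M * (bumpRadial z * fundamentalProfile α z θ)) = 0
    rw [tailCut_of_ge hM0 hz, bumpRadial_of_four_le (by linarith)]
    ring

end Elgindi

end Literature.Analysis.FluidPDE
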